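import Mathlib
import Summits.AtomisticToContinuum.Crystallization.Theses.PhononSlackCertificates
import Summits.AtomisticToContinuum.Crystallization.Theorems.PhononSlackCertificatesNearFarGlueRHoles
import Literature.MathematicalPhysics.StatisticalMechanics.LennardJonesClusters

/-!
# Crux `PhononSlackCertificates.NearFarGlueR` (stmt-AtomisticToContinuum-14970), line `Sketch`:
the SLAB form of the mirror principle (registered sub-goal `stub_slabMirror`, skeleton v6)

Lead c5 landed the ASSEMBLY / MIRROR principle (`…NearFarGlueRAssembly.lean`): gluing the mirror
copy of a finite injective configuration `x` across a supporting plane `⟪p, n⟫ = h` (`‖n‖ = 1`,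
every particle at signed distance `s_i − h ≥ 9/20`, `s_i = ⟪x_i, n⟫`) is a `2N`-particle
comparison configuration, so `N·e* ≤ 𝓔(x) + ½·Σ_i V(2(s_i − h))` (`e* = ⨅_Q e(Q)`,
`V` = Lennard-Jones): the outermost layer facing an empty half-space pays, `e*`-free and
lattice-free.

This file proves the SLAB form: particles between two parallel planes `⟪p, n⟫ = h₁` and
`⟪p, n⟫ = h₂` with margins `9/20` on both sides pay on BOTH faces at once,
`N·e* ≤ 𝓔(x) + ½·Σ_i [V(2(s_i − h₁)) + V(2(h₂ − s_i))]` (`stub_slabMirror`).  This is not one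
application of the assembly principle (the two reflections generate an infinite group) but the
limit of ITERATED DOUBLING (`slab_doubling`): if the slab inequality holds with face weights
`(θ₁, θ₂)`, `θ₁, θ₂ ≥ 0`, for ALL admissible data, then doubling `x` across its lower plane —
the configuration `x ⊕ σx`, `σ` the reflection in `⟪p, n⟫ = h₁`, lies in the slab
`[2h₁ − h₂, h₂]`, both of its faces are copies of the upper face of `x`, and the junction pays
the full lower face of `x` (each particle faces its own image at distance `2(s_i − h₁)`, every
other cross distance is `≥ 9/10`, where `V ≤ 0`) — yields the weights `(1, (θ₁ + θ₂)/2)`.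
From `(0, 0)` (periodisation, `card_mul_eStar_le`) one reaches `(1, 1 − 2^{−k})` for every `k`
(`slab_iterate`), and `k → ∞` gives `(1, 1)` because the face sums are `≤ 0`.  All `[folklore]`.
-/

noncomputable section

namespace Summit.AtomisticToContinuum.Crystallization.Theorems.PhononSlackCertificatesNearFarGlueR

open Literature.MathematicalPhysics.StatisticalMechanics
open Literature.Geometry.DiscreteGeometry
open Summit.AtomisticToContinuum.Crystallization.Theses.PhononSlackCertificates
open Summit.AtomisticToContinuum.Crystallization.Theorems.ChargedEnergyGapNegative
  (eStar card_mul_eStar_le)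
open scoped BigOperators RealInnerProductSpace

/-! ## §1 The reflection `p ↦ p − 2(⟪p, n⟫ − h)·n` in the plane `⟪p, n⟫ = h` (`‖n‖ = 1`) -/

-- The next five lemmas are adapted from `…NearFarGlueRAssembly.lean` (lead c5, p132457).

/-- The reflection preserves distances (`‖n‖ = 1`). [folklore] -/
private theorem slab_dist_mirror_mirror {n : EuclideanSpace ℝ (Fin 3)} (hn : ‖n‖ = 1) (h : ℝ)
    (p q : EuclideanSpace ℝ (Fin 3)) :
    dist (p - (2 * (⟪p, n⟫ - h)) • n) (q - (2 * (⟪q, n⟫ - h)) • n) = dist p q := by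
  have e : (p - (2 * (⟪p, n⟫ - h)) • n) - (q - (2 * (⟪q, n⟫ - h)) • n) =
      (p - q) - (2 * ⟪p - q, n⟫) • n := by
    simp only [inner_sub_left]
    module
  have hsq : ‖(p - (2 * (⟪p, n⟫ - h)) • n) - (q - (2 * (⟪q, n⟫ - h)) • n)‖ ^ 2 =
      ‖p - q‖ ^ 2 := by
    rw [e, norm_sub_sq_real, inner_smul_right, norm_smul, Real.norm_eq_abs, hn, mul_one,
      sq_abs]
    ring
  rw [dist_eq_norm, dist_eq_norm]
  exact (sq_eq_sq₀ (norm_nonneg _) (norm_nonneg _)).1 hsq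

/-- A particle faces its own image at twice its distance from the plane. [folklore] -/
private theorem slab_dist_mirror_self {n : EuclideanSpace ℝ (Fin 3)} (hn : ‖n‖ = 1) (h : ℝ)
    (p : EuclideanSpace ℝ (Fin 3)) (hp : 0 ≤ ⟪p, n⟫ - h) :
    dist p (p - (2 * (⟪p, n⟫ - h)) • n) = 2 * (⟪p, n⟫ - h) := by
  have e : p - (p - (2 * (⟪p, n⟫ - h)) • n) = (2 * (⟪p, n⟫ - h)) • n := by abel
  rw [dist_eq_norm, e, norm_smul, hn, mul_one, Real.norm_eq_abs, abs_of_nonneg (by linarith)]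

/-- Cross distances are at least the sum of the two signed distances from the plane.
[folklore] -/
private theorem slab_add_le_dist_mirror {n : EuclideanSpace ℝ (Fin 3)} (hn : ‖n‖ = 1) (h : ℝ)
    (p q : EuclideanSpace ℝ (Fin 3)) :
    (⟪p, n⟫ - h) + (⟪q, n⟫ - h) ≤ dist p (q - (2 * (⟪q, n⟫ - h)) • n) := by
  have hnn : ⟪n, n⟫ = (1 : ℝ) := by
    rw [real_inner_self_eq_norm_sq, hn]; norm_num
  have e : ⟪p - (q - (2 * (⟪q, n⟫ - h)) • n), n⟫ = (⟪p, n⟫ - h) + (⟪q, n⟫ - h) := by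
    simp only [inner_sub_left, inner_smul_left, hnn, RCLike.conj_to_real]
    ring
  rw [dist_eq_norm, ← e]
  calc ⟪p - (q - (2 * (⟪q, n⟫ - h)) • n), n⟫ ≤ |⟪p - (q - (2 * (⟪q, n⟫ - h)) • n), n⟫| :=
        le_abs_self _
    _ ≤ ‖p - (q - (2 * (⟪q, n⟫ - h)) • n)‖ * ‖n‖ := abs_real_inner_le_norm _ _
    _ = ‖p - (q - (2 * (⟪q, n⟫ - h)) • n)‖ := by rw [hn, mul_one]

/-- A distance-preserving map carries a configuration to one of the same energy. [folklore] -/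
private theorem slab_interactionEnergy_comp {N : ℕ} (x : Fin N → EuclideanSpace ℝ (Fin 3))
    (σ : EuclideanSpace ℝ (Fin 3) → EuclideanSpace ℝ (Fin 3))
    (hσ : ∀ p q, dist (σ p) (σ q) = dist p q) :
    interactionEnergy lennardJones (σ ∘ x) = interactionEnergy lennardJones x := by
  unfold interactionEnergy
  simp only [Function.comp_apply, hσ]

/-- A distance-preserving map carries an injective configuration to an injective one.
[folklore] -/
private theorem slab_injective_comp {N : ℕ} {x : Fin N → EuclideanSpace ℝ (Fin 3)}
    (hx : Function.Injective x) (σ : EuclideanSpace ℝ (Fin 3) → EuclideanSpace ℝ (Fin 3))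
    (hσ : ∀ p q, dist (σ p) (σ q) = dist p q) : Function.Injective (σ ∘ x) := by
  intro l l' hl
  apply hx
  have h0 : dist (σ (x l)) (σ (x l')) = 0 := by rw [dist_eq_zero]; exact hl
  rw [hσ] at h0
  exact dist_eq_zero.1 h0

/-- The image of `p` lies at height `2h − ⟪p, n⟫`. [folklore] -/
private theorem slab_inner_mirror {n : EuclideanSpace ℝ (Fin 3)} (hn : ‖n‖ = 1) (h : ℝ)
    (p : EuclideanSpace ℝ (Fin 3)) : ⟪p - (2 * (⟪p, n⟫ - h)) • n, n⟫ = 2 * h - ⟪p, n⟫ := by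
  have hnn : ⟪n, n⟫ = (1 : ℝ) := by
    rw [real_inner_self_eq_norm_sq, hn]; norm_num
  rw [inner_sub_left, real_inner_smul_left, hnn]
  ring

/-! ## §2 Doubling across the lower plane -/

/-- **Doubling step.**  If the slab inequality holds with face weights `(θ₁, θ₂)`, `θ₁, θ₂ ≥ 0`,
for all admissible data, then it holds with weights `(1, (θ₁ + θ₂)/2)`: apply it to the doubled
configuration `x ⊕ σx` (`σ` the reflection in the lower plane `⟪p, n⟫ = h₁`) in the slab
`[2h₁ − h₂, h₂]`; its energy is `2𝓔(x) +` the cross sum, which is at most the lower face sum of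
`x` (self-pairs at distance `2(s_i − h₁)`, all other cross distances `≥ 9/10`), its two faces are
copies of the upper face of `x`, and the two spurious face sums are `≤ 0`. [folklore] -/
theorem slab_doubling {θ₁ θ₂ : ℝ} (hθ₁ : 0 ≤ θ₁) (hθ₂ : 0 ≤ θ₂)
    (H : ∀ (N : ℕ) (x : Fin N → EuclideanSpace ℝ (Fin 3)), Function.Injective x →
      ∀ (n : EuclideanSpace ℝ (Fin 3)), ‖n‖ = 1 → ∀ h₁ h₂ : ℝ,
      (∀ i : Fin N, (9 / 20 : ℝ) ≤ ⟪x i, n⟫ - h₁) →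
      (∀ i : Fin N, (9 / 20 : ℝ) ≤ h₂ - ⟪x i, n⟫) →
      (N : ℝ) * (⨅ Q : PeriodicConfiguration 3, Q.energyPerParticle lennardJones) ≤
        interactionEnergy lennardJones x +
          (1 / 2 : ℝ) * (θ₁ * (∑ i, lennardJones (2 * (⟪x i, n⟫ - h₁))) +
            θ₂ * (∑ i, lennardJones (2 * (h₂ - ⟪x i, n⟫)))))
    {N : ℕ} (x : Fin N → EuclideanSpace ℝ (Fin 3)) (hx : Function.Injective x)
    {n : EuclideanSpace ℝ (Fin 3)} (hn : ‖n‖ = 1) (h₁ h₂ : ℝ)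
    (hlow : ∀ i : Fin N, (9 / 20 : ℝ) ≤ ⟪x i, n⟫ - h₁)
    (hup : ∀ i : Fin N, (9 / 20 : ℝ) ≤ h₂ - ⟪x i, n⟫) :
    (N : ℝ) * (⨅ Q : PeriodicConfiguration 3, Q.energyPerParticle lennardJones) ≤
      interactionEnergy lennardJones x +
        (1 / 2 : ℝ) * (1 * (∑ i, lennardJones (2 * (⟪x i, n⟫ - h₁))) +
          (θ₁ + θ₂) / 2 * (∑ i, lennardJones (2 * (h₂ - ⟪x i, n⟫)))) := by
  -- the reflection in the lower plane, kept opaque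
  obtain ⟨σ, hσdef⟩ : ∃ σ : EuclideanSpace ℝ (Fin 3) → EuclideanSpace ℝ (Fin 3),
      ∀ p, σ p = p - (2 * (⟪p, n⟫ - h₁)) • n := ⟨_, fun _ => rfl⟩
  have hσ : ∀ p q, dist (σ p) (σ q) = dist p q := fun p q => by
    rw [hσdef, hσdef]; exact slab_dist_mirror_mirror hn h₁ p q
  have hinner : ∀ p, ⟪σ p, n⟫ = 2 * h₁ - ⟪p, n⟫ := fun p => by
    rw [hσdef]; exact slab_inner_mirror hn h₁ p
  have hcross : ∀ i l : Fin N, (9 / 10 : ℝ) ≤ dist (x i) (σ (x l)) := fun i l => by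
    have := slab_add_le_dist_mirror hn h₁ (x i) (x l)
    rw [← hσdef] at this
    linarith [hlow i, hlow l]
  have hoff : ∀ (l i : Fin N), (σ ∘ x) l ≠ x i := fun l i heq => by
    have := hcross i l
    rw [Function.comp_apply] at heq
    rw [heq, dist_self] at this
    linarith
  have hy : Function.Injective (Fin.append x (σ ∘ x)) :=
    append_injective hx (slab_injective_comp hx σ hσ) hoff
  -- the doubled configuration lies in the slab `[2h₁ - h₂, h₂]` with margins `9/20`
  have hlow' : ∀ j : Fin (N + N),
      (9 / 20 : ℝ) ≤ ⟪Fin.append x (σ ∘ x) j, n⟫ - (2 * h₁ - h₂) := by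
    intro j
    induction j using Fin.addCases with
    | left i => rw [Fin.append_left]; linarith [hlow i, hup i]
    | right i => rw [Fin.append_right, Function.comp_apply, hinner]; linarith [hup i]
  have hup' : ∀ j : Fin (N + N), (9 / 20 : ℝ) ≤ h₂ - ⟪Fin.append x (σ ∘ x) j, n⟫ := by
    intro j
    induction j using Fin.addCases with
    | left i => rw [Fin.append_left]; linarith [hup i]
    | right i => rw [Fin.append_right, Function.comp_apply, hinner]; linarith [hlow i, hup i]
  have hH := H (N + N) (Fin.append x (σ ∘ x)) hy n hn (2 * h₁ - h₂) h₂ hlow' hup'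
  -- express everything through `x`
  have harg : ∀ s : ℝ, 2 * (2 * h₁ - s - (2 * h₁ - h₂)) = 2 * (h₂ - s) := fun s => by ring
  rw [interactionEnergy_append lennardJones lennardJones_zero x (σ ∘ x),
    slab_interactionEnergy_comp x σ hσ, Nat.cast_add] at hH
  simp only [Fin.sum_univ_add, Fin.append_left, Fin.append_right, Function.comp_apply, hinner,
    harg] at hH
  -- the cross sum is at most the lower face sum of `x`
  have hrow : ∀ i : Fin N, ∑ l, lennardJones (dist (x i) (σ (x l))) ≤
      lennardJones (2 * (⟪x i, n⟫ - h₁)) := fun i => by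
    rw [← Finset.add_sum_erase _ _ (Finset.mem_univ i)]
    have hself : dist (x i) (σ (x i)) = 2 * (⟪x i, n⟫ - h₁) := by
      rw [hσdef]; exact slab_dist_mirror_self hn h₁ (x i) (by linarith [hlow i])
    have hrest : ∑ l ∈ Finset.univ.erase i, lennardJones (dist (x i) (σ (x l))) ≤ 0 :=
      Finset.sum_nonpos fun l _ => lennardJones_nonpos_of_ge_nine_tenths (hcross i l)
    rw [hself]
    linarith
  have hsumA : ∑ i, ∑ l, lennardJones (dist (x i) (σ (x l))) ≤
      ∑ i, lennardJones (2 * (⟪x i, n⟫ - h₁)) := Finset.sum_le_sum fun i _ => hrow i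
  -- the two spurious face sums are nonpositive
  have hA1 : ∑ i, lennardJones (2 * (⟪x i, n⟫ - (2 * h₁ - h₂))) ≤ 0 :=
    Finset.sum_nonpos fun i _ =>
      lennardJones_nonpos_of_ge_nine_tenths (by linarith [hlow i, hup i])
  have hB2 : ∑ i, lennardJones (2 * (h₂ - (2 * h₁ - ⟪x i, n⟫))) ≤ 0 :=
    Finset.sum_nonpos fun i _ =>
      lennardJones_nonpos_of_ge_nine_tenths (by linarith [hlow i, hup i])
  have p1 := mul_nonpos_of_nonneg_of_nonpos hθ₁ hA1
  have p2 := mul_nonpos_of_nonneg_of_nonpos hθ₂ hB2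
  have hB : ∑ i, lennardJones (2 * (h₂ - ⟪x i, n⟫)) ≤ 0 :=
    Finset.sum_nonpos fun i _ => lennardJones_nonpos_of_ge_nine_tenths (by linarith [hup i])
  linarith

/-! ## §3 Iteration and the limit -/

/-- **Iterated doubling.**  For every `k`, the slab inequality holds with face weights
`(1, 1 − 2^{−k})` for all admissible data: weights `(0, 0)` are periodisation
(`card_mul_eStar_le`), and `slab_doubling` maps `(θ₁, θ₂) ↦ (1, (θ₁ + θ₂)/2)`. [folklore] -/
theorem slab_iterate (k : ℕ) :
    ∀ (N : ℕ) (x : Fin N → EuclideanSpace ℝ (Fin 3)), Function.Injective x →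
      ∀ (n : EuclideanSpace ℝ (Fin 3)), ‖n‖ = 1 → ∀ h₁ h₂ : ℝ,
      (∀ i : Fin N, (9 / 20 : ℝ) ≤ ⟪x i, n⟫ - h₁) →
      (∀ i : Fin N, (9 / 20 : ℝ) ≤ h₂ - ⟪x i, n⟫) →
      (N : ℝ) * (⨅ Q : PeriodicConfiguration 3, Q.energyPerParticle lennardJones) ≤
        interactionEnergy lennardJones x +
          (1 / 2 : ℝ) * (1 * (∑ i, lennardJones (2 * (⟪x i, n⟫ - h₁))) +
            (1 - (1 / 2 : ℝ) ^ k) * (∑ i, lennardJones (2 * (h₂ - ⟪x i, n⟫)))) := by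
  induction k with
  | zero =>
    intro N x hx n hn h₁ h₂ hlow hup
    have h0 : ∀ (N : ℕ) (x : Fin N → EuclideanSpace ℝ (Fin 3)), Function.Injective x →
        ∀ (n : EuclideanSpace ℝ (Fin 3)), ‖n‖ = 1 → ∀ h₁ h₂ : ℝ,
        (∀ i : Fin N, (9 / 20 : ℝ) ≤ ⟪x i, n⟫ - h₁) →
        (∀ i : Fin N, (9 / 20 : ℝ) ≤ h₂ - ⟪x i, n⟫) →
        (N : ℝ) * (⨅ Q : PeriodicConfiguration 3, Q.energyPerParticle lennardJones) ≤
          interactionEnergy lennardJones x +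
            (1 / 2 : ℝ) * (0 * (∑ i, lennardJones (2 * (⟪x i, n⟫ - h₁))) +
              0 * (∑ i, lennardJones (2 * (h₂ - ⟪x i, n⟫)))) :=
      fun N x hx n _ h₁ h₂ _ _ => by
        have h := card_mul_eStar_le hx
        change (N : ℝ) * (⨅ Q : PeriodicConfiguration 3, Q.energyPerParticle lennardJones) ≤ _
          at h
        linarith
    have h := slab_doubling le_rfl le_rfl h0 x hx hn h₁ h₂ hlow hup
    have e : ((0 : ℝ) + 0) / 2 = 1 - (1 / 2 : ℝ) ^ 0 := by norm_num
    rw [e] at h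
    exact h
  | succ k ih =>
    intro N x hx n hn h₁ h₂ hlow hup
    have hθ : (0 : ℝ) ≤ 1 - (1 / 2 : ℝ) ^ k := by
      have : (1 / 2 : ℝ) ^ k ≤ 1 := pow_le_one₀ (by norm_num) (by norm_num)
      linarith
    have h := slab_doubling zero_le_one hθ ih x hx hn h₁ h₂ hlow hup
    have e : ((1 : ℝ) + (1 - (1 / 2 : ℝ) ^ k)) / 2 = 1 - (1 / 2 : ℝ) ^ (k + 1) := by ring
    rw [e] at h
    exact h

/-- **Slab mirror principle.**  If every particle of a finite injective configuration lies
between the planes `⟪p, n⟫ = h₁` and `⟪p, n⟫ = h₂` (`‖n‖ = 1`) with margins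
`⟪x_i, n⟫ − h₁ ≥ 9/20` and `h₂ − ⟪x_i, n⟫ ≥ 9/20`, then
`N·e* ≤ 𝓔_LJ(x) + ½·Σ_i [V(2(⟪x_i, n⟫ − h₁)) + V(2(h₂ − ⟪x_i, n⟫))]`: both faces pay at once
(`slab_iterate` and `k → ∞`, the face sums being `≤ 0`). [folklore] -/
theorem slab_mirror_principle {N : ℕ} (x : Fin N → EuclideanSpace ℝ (Fin 3))
    (hx : Function.Injective x) {n : EuclideanSpace ℝ (Fin 3)} (hn : ‖n‖ = 1) (h₁ h₂ : ℝ)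
    (hlow : ∀ i : Fin N, (9 / 20 : ℝ) ≤ ⟪x i, n⟫ - h₁)
    (hup : ∀ i : Fin N, (9 / 20 : ℝ) ≤ h₂ - ⟪x i, n⟫) :
    (N : ℝ) * (⨅ Q : PeriodicConfiguration 3, Q.energyPerParticle lennardJones) ≤
      interactionEnergy lennardJones x +
        (1 / 2 : ℝ) * ((∑ i, lennardJones (2 * (⟪x i, n⟫ - h₁))) +
          ∑ i, lennardJones (2 * (h₂ - ⟪x i, n⟫))) := by
  set B := ∑ i, lennardJones (2 * (h₂ - ⟪x i, n⟫)) with hBdef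
  have hB : B ≤ 0 :=
    Finset.sum_nonpos fun i _ => lennardJones_nonpos_of_ge_nine_tenths (by linarith [hup i])
  refine le_of_forall_pos_le_add fun ε hε => ?_
  obtain ⟨k, hk⟩ := exists_pow_lt_of_lt_one (div_pos hε (by linarith : (0 : ℝ) < -B + 1))
    (by norm_num : (1 / 2 : ℝ) < 1)
  have ht : (0 : ℝ) ≤ (1 / 2 : ℝ) ^ k := by positivity
  have hkk : (1 / 2 : ℝ) ^ k * (-B + 1) < ε := (lt_div_iff₀ (by linarith)).1 hk
  have h1 : (1 / 2 : ℝ) ^ k * (-B) ≤ (1 / 2 : ℝ) ^ k * (-B + 1) :=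
    mul_le_mul_of_nonneg_left (by linarith) ht
  have h := slab_iterate k N x hx n hn h₁ h₂ hlow hup
  have e : (1 / 2 : ℝ) * (1 * (∑ i, lennardJones (2 * (⟪x i, n⟫ - h₁))) +
      (1 - (1 / 2 : ℝ) ^ k) * B) =
      (1 / 2 : ℝ) * ((∑ i, lennardJones (2 * (⟪x i, n⟫ - h₁))) + B) +
        (1 / 2 : ℝ) * ((1 / 2 : ℝ) ^ k * (-B)) := by ring
  rw [e] at h
  linarith

/-- **Registered sub-goal `stub_slabMirror` of the line `Sketch` (skeleton v6)** — the slab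
mirror principle in closed form (`inner ℝ (x i) n` written out for the registered signature).
[folklore] -/
theorem stub_slabMirror :
    ∀ (N : ℕ) (x : Fin N → EuclideanSpace ℝ (Fin 3)), Function.Injective x →
    ∀ (n : EuclideanSpace ℝ (Fin 3)), ‖n‖ = 1 → ∀ h₁ h₂ : ℝ,
      (∀ i : Fin N, (9 / 20 : ℝ) ≤ inner ℝ (x i) n - h₁) →
      (∀ i : Fin N, (9 / 20 : ℝ) ≤ h₂ - inner ℝ (x i) n) →
      (N : ℝ) * (⨅ Q : PeriodicConfiguration 3, Q.energyPerParticle lennardJones) ≤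
        interactionEnergy lennardJones x +
          (1 / 2 : ℝ) * ∑ i : Fin N, (lennardJones (2 * (inner ℝ (x i) n - h₁)) +
            lennardJones (2 * (h₂ - inner ℝ (x i) n))) := by
  intro N x hx n hn h₁ h₂ hlow hup
  rw [Finset.sum_add_distrib]
  exact slab_mirror_principle x hx hn h₁ h₂ hlow hup

end Summit.AtomisticToContinuum.Crystallization.Theorems.PhononSlackCertificatesNearFarGlueR

end
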